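import Mathlib
import HarnessLib
import Summits.NavierStokesRegularity.NavierStokesRegularity.Theorems.TaylorModelRungThreeCertificateCoreStep
import Summits.NavierStokesRegularity.NavierStokesRegularity.Theorems.TaylorModelRungThreeCertificateFormatVBridge

/-!
# Crux K1b-DR (stmt-NavierStokesRegularity-23954), line `taylor-model` — v3 read-outs, K-SIDE part 1: the STATE tests
# (R4) window `M`-bounds, (R5) section before/after, (R7) transversality, (R8) crossing read-outs (typer g32;
# semantic clauses = ns-tm-g4 g3's `ReadoutsV` in `…VReadoutsDefs` p625517; interpretation = engine-1 g67's `toBoxesW`)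

Boolean kernels on rounded dyadic interval boxes (`IntervalD`) and their per-clause soundness, in the same pattern as
`coreStep` (`…CertificateCoreStep*`): every semantic input is an INTERVAL ENCLOSURE (the stage scalars `M k`, the allowance
`Λ·δ·τs·ω k + mm`, the section covector's coefficients, `lev`, `γ`, `as`, a certified dyadic lower surrogate of
`2^(-θ)·Cb·2^(3(Kb+1)/4)`), every state set is a coordinate box `Y` read through the window values `T.wv y` (`MemVec T.n (T.wv y) Y`),
and each test compares SAFE interval ends by exact dyadic comparisons:

* `IntervalD.dotR` / `mem_dotR` — rounded interval dot product; `CertTables.mem_covR_dotR` — the list-coded window functional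
  `covR φ w` (`= Σ_c φ(w_c)·wv y c`, `covR_apply`) over a box, given coefficient enclosures `φ (w_c) ∈ WB[c]`;
* `testR4` / `testR4_sound` — (R4) on one sub-step's `CoreOut` (`lo ⊕ loK ≥ −M`, `hi ⊕ hiK ≤ M`, `lo ≥ −(M − a)`, `hi ≤ M − a`);
* `testR5` / `testR5_sound` — (R5) `σf < lev` on the box before, `lev < σf` on the box after (strict, via `dotR`);
* `testR7` / `testR7_sound` — (R7) `γ ≤ σf (Qb y y)` on a box, through the sparse field twin `qBboxMA` (`Qb y y = qBf y y`);
* `testR8` / `testR8_sound` — (R8) `as ≤ |y i₀ 1|` (sign-definite coordinate interval) and the behind-shell bound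
  `|y i (−Kb)| + a_{−Kb} ≤ R` against a dyadic `rlo ≤ R`, IGNORING the section equation `σf y = lev` (sound: it only shrinks the set).

HONEST FRAMING: kernel bookkeeping for the MODEL certificate №23954 (rung TL-M3); nothing here is a statement about the
Navier–Stokes equations.
-/

-- the sub-problem namespace repeats the summit name by design (D-0017)
set_option linter.dupNamespace false

namespace Summit.NavierStokesRegularity.NavierStokesRegularity.Theorems.TaylorModelCert

open scoped BigOperators
open Set
open Literature.Analysis.FluidPDE.TaoCascade Literature.Analysis.FluidPDE.TaoCascade.TaylorChain
open Summit.NavierStokesRegularity.NavierStokesRegularity.Theorems.TaylorModelReadout (qB Qb_eq)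

namespace IntervalD

/-- Rounded interval DOT PRODUCT `Σ_{c<n} W[c]·Y[c]`. [folklore] -/
def dotR (prec n : ℕ) (W Y : Array IntervalD) : IntervalD :=
  rangeSumR prec (fun c => mulR prec (aget W c) (aget Y c)) n

/-- Soundness of `dotR`: `Σ_{c<n} a c · y c ∈ dotR W Y` when `a c ∈ W[c]`, `y c ∈ Y[c]`. [folklore] -/
theorem mem_dotR (prec n : ℕ) {W Y : Array IntervalD} {a y : ℕ → ℝ}
    (ha : ∀ c < n, mem (a c) (aget W c)) (hy : ∀ c < n, mem (y c) (aget Y c)) :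
    mem (∑ c ∈ Finset.range n, a c * y c) (dotR prec n W Y) :=
  mem_rangeSumR prec n fun c hc => mem_mulR prec (ha c hc) (hy c hc)

/-- `Fin 4`-conjunction as a Boolean. [folklore] -/
def allFin4 (p : Fin 4 → Bool) : Bool := p 0 && p 1 && p 2 && p 3

/-- [folklore] -/
theorem allFin4_eq_true {p : Fin 4 → Bool} (h : allFin4 p = true) : ∀ i, p i = true := by
  simp only [allFin4, Bool.and_eq_true] at h
  obtain ⟨⟨⟨h0, h1⟩, h2⟩, h3⟩ := h
  intro i; fin_cases i <;> assumption

end IntervalD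

namespace CertTables

variable {K : Type} [Field K] {φ : K →+* ℝ} (T : CertTables K)

/-! ### The window functional over a box -/

/-- The functional `covR φ w` over a box: `covR φ w y ∈ dotR WB Y` whenever the coefficients are enclosed
(`φ (w_c) ∈ WB[c]`, `c < n`) and `wv y ∈ Y`. [folklore] -/
theorem mem_covR_dotR {w : List K} {WB : Array IntervalD} (hW : ∀ c < T.n, IntervalD.mem (φ (vget w c)) (IntervalD.aget WB c)) (prec : ℕ)
    {y : Fin 4 → ℤ → ℝ} {Y : Array IntervalD} (hy : MemVec T.n (T.wv y) Y) :
    IntervalD.mem (T.covR φ w y) (IntervalD.dotR prec T.n WB Y) := by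
  rw [T.covR_apply φ w y]
  exact IntervalD.mem_dotR prec T.n hW hy

/-! ### (R4) window `M`-bounds of one sub-step -/

/-- **(R4) TEST** on one sub-step's core output: with `M k ∈ MB[idx i k]` and the allowance `a k ∈ AB[idx i k]`
(`a k = Λ·δ·τs·ω k + mm`), per coordinate `−MB.lo ≤ lo + loK`, `hi + hiK ≤ MB.lo`, `AB.hi − MB.lo ≤ lo`, `hi ≤ MB.lo − AB.hi`. [folklore] -/
def testR4 (MB AB : Array IntervalD) (co : CoreOut) : Bool :=
  allN T.n fun c =>
    Dyad.ble (Dyad.neg (IntervalD.aget MB c).lo) (Dyad.add (dget co.lo c) (dget co.loK c)) &&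
    Dyad.ble (Dyad.add (dget co.hi c) (dget co.hiK c)) (IntervalD.aget MB c).lo &&
    Dyad.ble (Dyad.sub (IntervalD.aget AB c).hi (IntervalD.aget MB c).lo) (dget co.lo c) &&
    Dyad.ble (dget co.hi c) (Dyad.sub (IntervalD.aget MB c).lo (IntervalD.aget AB c).hi)

omit [Field K] in
/-- **Soundness of (R4)** in window form (the boxes read through `vecF ∘ vre` as in `toBoxesW`). [folklore] -/
theorem testR4_sound {MB AB : Array IntervalD} {co : CoreOut} (h : T.testR4 MB AB co = true)
    {M a : ℤ → ℝ} (hM : ∀ i k, -T.Kb ≤ k → k ≤ T.Ka → IntervalD.mem (M k) (IntervalD.aget MB (T.idx i k)))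
    (hA : ∀ i k, -T.Kb ≤ k → k ≤ T.Ka → IntervalD.mem (a k) (IntervalD.aget AB (T.idx i k)))
    (i : Fin 4) {k : ℤ} (hk1 : -T.Kb ≤ k) (hk2 : k ≤ T.Ka) :
    -M k ≤ T.vecF (vre co.lo) i k + T.vecF (vre co.loK) i k ∧
    T.vecF (vre co.hi) i k + T.vecF (vre co.hiK) i k ≤ M k ∧
    -(M k - a k) ≤ T.vecF (vre co.lo) i k ∧ T.vecF (vre co.hi) i k ≤ M k - a k := by
  have hc : T.idx i k < T.n := T.idx_lt_n i ⟨hk1, hk2⟩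
  have hb := (allN_eq_true.1 h) _ hc
  simp only [Bool.and_eq_true, Dyad.ble_iff, Dyad.toReal_neg, Dyad.toReal_add, Dyad.toReal_sub] at hb
  obtain ⟨⟨⟨h1, h2⟩, h3⟩, h4⟩ := hb
  have hMlo := (hM i k hk1 hk2).1
  have hAhi := (hA i k hk1 hk2).2
  simp only [T.vecF_apply, hk1, hk2, and_self, if_true, vre]
  refine ⟨?_, ?_, ?_, ?_⟩ <;> linarith

/-! ### (R5) section before / after -/

/-- **(R5) TEST**: `sup σf < lev` over the box `Hb` (node `S−1`) and `lev < inf σf` over the box `Ha` (node `S`), the functional's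
range over a box enclosed by `dotR`. [folklore] -/
def testR5 (prec : ℕ) (WB : Array IntervalD) (LB : IntervalD) (Hb Ha : Array IntervalD) : Bool :=
  Dyad.blt (IntervalD.dotR prec T.n WB Hb).hi LB.lo && Dyad.blt LB.hi (IntervalD.dotR prec T.n WB Ha).lo

/-- **Soundness of (R5).** [folklore] -/
theorem testR5_sound {prec : ℕ} {w : List K} {WB : Array IntervalD}
    (hW : ∀ c < T.n, IntervalD.mem (φ (vget w c)) (IntervalD.aget WB c)) {lev : ℝ} {LB : IntervalD}
    (hL : IntervalD.mem lev LB) {Hb Ha : Array IntervalD} (h : T.testR5 prec WB LB Hb Ha = true) :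
    (∀ y : Fin 4 → ℤ → ℝ, MemVec T.n (T.wv y) Hb → T.covR φ w y < lev) ∧
    (∀ y : Fin 4 → ℤ → ℝ, MemVec T.n (T.wv y) Ha → lev < T.covR φ w y) := by
  simp only [testR5, Bool.and_eq_true, Dyad.blt_iff] at h
  refine ⟨fun y hy => ?_, fun y hy => ?_⟩
  · have hm := T.mem_covR_dotR hW prec hy
    exact lt_of_le_of_lt hm.2 (lt_of_lt_of_le h.1 hL.1)
  · have hm := T.mem_covR_dotR hW prec hy
    exact lt_of_le_of_lt hL.2 (lt_of_lt_of_le h.2 hm.1)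

/-! ### (R7) transversality -/

/-- **(R7) TEST**: `γ ≤ inf σf (Qb y y)` over the box `Y`, the quadratic form enclosed coordinatewise by the sparse field twin
`qBboxMA` and then paired with the covector box. [folklore] -/
def testR7 (coefB : Fin 4 → Fin 4 → Fin 4 → ℕ → ℤ → IntervalD) (prec : ℕ) (mt : Array (List (ℕ × ℕ × ℕ)))
    (WB : Array IntervalD) (GB : IntervalD) (Y : Array IntervalD) : Bool :=
  Dyad.ble GB.hi (IntervalD.dotR prec T.n WB (T.qBboxMA coefB prec mt Y Y)).lo

/-- The diagonal of `Qb` is the fast bilinear form `qBf`. [folklore] -/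
theorem Qb_diag_eq_qBf (y : Fin 4 → ℤ → ℝ) : (T.toCertData φ).Qb y y = qBf (T.toCertData φ) y y := by
  funext i k
  simp only [Qb_eq, qBf]
  ring

/-- **Soundness of (R7).** [folklore] -/
theorem testR7_sound (hco : T.CoefOK φ) {coefB : Fin 4 → Fin 4 → Fin 4 → ℕ → ℤ → IntervalD} (hcB : CoefBoxOK φ T coefB)
    {mt : Array (List (ℕ × ℕ × ℕ))} (hmt : mt = T.monosTable coefB) {prec : ℕ} {w : List K} {WB : Array IntervalD}
    (hW : ∀ c < T.n, IntervalD.mem (φ (vget w c)) (IntervalD.aget WB c)) {γ : ℝ} {GB : IntervalD} (hG : IntervalD.mem γ GB) {Y : Array IntervalD} (hY : Y.size = T.n)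
    (h : T.testR7 coefB prec mt WB GB Y = true) :
    ∀ y : Fin 4 → ℤ → ℝ, MemVec T.n (T.wv y) Y → γ ≤ T.covR φ w ((T.toCertData φ).Qb y y) := by
  intro y hy
  simp only [testR7, Dyad.ble_iff] at h
  subst hmt
  have hQ : MemVec T.n (T.wv ((T.toCertData φ).Qb y y)) (T.qBboxMA coefB prec (T.monosTable coefB) Y Y) := by
    intro c hc
    rw [T.Qb_diag_eq_qBf]
    exact T.isFieldEnclosureA_qBboxMA hco hcB prec Y Y y y hY hY hy hy c hc
  have hm := T.mem_covR_dotR hW prec hQ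
  exact le_trans hG.2 (le_trans h hm.1)

/-! ### (R8) crossing read-outs on a box (section equation ignored) -/

/-- **(R8) TEST** on the box `Y`: shell `1` is in the window; the coordinate interval of `y i₀ 1` is sign-definite beyond `as`
(`ASB.hi ≤ Y.lo` or `Y.hi ≤ −ASB.hi`); and for every component `i`, `mag Y[idx i (−Kb)] + AK.hi ≤ rlo`. [folklore] -/
def testR8 (ASB AK : IntervalD) (rlo : Dyad) (Y : Array IntervalD) : Bool :=
  decide (-T.Kb ≤ 1 ∧ (1 : ℤ) ≤ T.Ka) &&
  (Dyad.ble ASB.hi (IntervalD.aget Y (T.idx T.i₀ 1)).lo ||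
    Dyad.ble (IntervalD.aget Y (T.idx T.i₀ 1)).hi (Dyad.neg ASB.hi)) &&
  IntervalD.allFin4 fun i => Dyad.ble (Dyad.add (IntervalD.mag (IntervalD.aget Y (T.idx i (-T.Kb)))) AK.hi) rlo

omit [Field K] in
/-- **Soundness of (R8)**: with `as ∈ ASB`, `aK ∈ AK` (`aK = Λ·δ·τs·ω(−Kb)`) and a dyadic `rlo ≤ R`
(`R = 2^(-θ)·(Cb·2^(3(Kb+1)/4))`, certified from the `ReadoutAux` surrogates on the caller's side), every state of the box
satisfies `as ≤ |y i₀ 1|` and `|y i (−Kb)| + aK ≤ R`. [folklore] -/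
theorem testR8_sound {ASB AK : IntervalD} {rlo : Dyad} {Y : Array IntervalD} (h : T.testR8 ASB AK rlo Y = true)
    {as aK R : ℝ} (has : IntervalD.mem as ASB) (haK : IntervalD.mem aK AK) (hR : rlo.toReal ≤ R) :
    ∀ y : Fin 4 → ℤ → ℝ, MemVec T.n (T.wv y) Y → as ≤ |y T.i₀ 1| ∧ ∀ i, |y i (-T.Kb)| + aK ≤ R := by
  intro y hy
  simp only [testR8, Bool.and_eq_true, Bool.or_eq_true, decide_eq_true_eq, Dyad.ble_iff, Dyad.toReal_neg] at h
  obtain ⟨⟨hk1, hsign⟩, hbeh⟩ := h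
  have hKK : -T.Kb ≤ -T.Kb ∧ -T.Kb ≤ T.Ka := ⟨le_rfl, by linarith [hk1.1, hk1.2]⟩
  refine ⟨?_, fun i => ?_⟩
  · have hm := hy (T.idx T.i₀ 1) (T.idx_lt_n T.i₀ hk1)
    rw [T.wv_idx y T.i₀ hk1] at hm
    rcases hsign with hs | hs
    · have h1 : as ≤ y T.i₀ 1 := le_trans has.2 (le_trans hs hm.1)
      exact le_trans h1 (le_abs_self _)
    · have h1 : y T.i₀ 1 ≤ -as := le_trans hm.2 (by linarith [has.2])
      exact le_trans (by linarith) (neg_le_abs _)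
  · have hb := IntervalD.allFin4_eq_true hbeh i
    simp only [Dyad.ble_iff, Dyad.toReal_add] at hb
    have hm := hy (T.idx i (-T.Kb)) (T.idx_lt_n i hKK)
    rw [T.wv_idx y i hKK] at hm
    have habs := IntervalD.abs_le_mag hm
    linarith [haK.2]

end CertTables

end Summit.NavierStokesRegularity.NavierStokesRegularity.Theorems.TaylorModelCert
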